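import Literature.Computability.QuantumComplexity.StabilizerFidelityMagicT
import HarnessLib

/-!
# A floor for the approximate stabilizer rank of `|T⟩^{⊗n}` over the product dictionary

Bravyi–Browne–Calpin–Campbell–Gosset–Howard (Quantum 3 (2019) 181 = arXiv:1808.00128), §2 Prop. 3
= §5.4 Theorem 3, with their Lemma 8: for every `S ⊆ 𝔽₂ⁿ` and every UNIT vector `φ` in the span of
the product stabilizer states `|x̃⟩ = ⊗ᵢ|x̃ᵢ⟩`, `x ∈ S` (`|0̃⟩ = |0⟩`, `|1̃⟩ = |+⟩`; here in the
Clifford-equivalent `T`-picture `|x̂⟩ = ⊗ᵢ σ_T(xᵢ)`, `σ_T(0) = |+⟩`, `σ_T(1) = |+i⟩ = S|+⟩`, against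
`magicT^{⊗n}`), `|S| ≥ |⟨T^{⊗n}|φ⟩|² · cos(π/8)^{-2n}`. This is the one printed EXPONENTIAL lower
bound on an approximate stabilizer rank of `T^{⊗n}` — RESTRICTED to Bravyi–Gosset's product family
(arXiv:1601.07601, Suppl. §5), where it matches, up to the `δ`-factors, Bravyi–Gosset's
`O(δ⁻² cos(π/8)^{-2n})` construction in the same family [BravyiEtAl2019, §2 eq. (11), p. 6:
`χ_δ(T^{⊗m}) ≤ δ^{-2} cos(π/8)^{-2m}`; BravyiGosset2016, Suppl. §5, p. 12: "best possible scaling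
`χ = O(ν^{-2t})` of any decomposition of the form (Lsubspace)"]; that construction is the INPUT of the
tree's `BravyiEtAl2019_approxStabilizerRank_magicT_pow_holds` and is not retyped here. Scope sentence
(lead flag F-a, verbatim): the UNRESTRICTED δ-approximate rank of T^{⊗n} stays Ω̃(n²) (L-04) and the
BG16 Ω(cos^{−2n}) conjecture stays OPEN.

## Contents (all statements PROVED here; no named facts, no `Prop` records)

* §1 `kernelForm_nonneg_and_sq_sum_le`, `sq_sum_le_card_mul_kernel` — Lemma 8 in quadratic-form
  phrasing, `(Σ_{x∈S} a_x)² ≤ |S| · Σ_{x,y∈S} a_x a_y t^{d(x,y)}` for ALL `t ∈ [0,1]` and real `a`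
  (equivalently `𝟙ᵀ G_S⁻¹ 𝟙 ≤ |S|` for the principal submatrices of `G = (t^{|x⊕y|})`, when
  invertible). NEW ELEMENTARY PROOF (the printed one writes `G` as a mixture over `S_n` of ultrametric
  matrices and uses that their inverses are diagonally dominant `Z`-matrices [MMM, Nabben–Varga] plus
  operator convexity of `x⁻¹`): slice the first coordinate, `a ↦ (a₀, a₁)` on `𝔽₂ⁿ⁻¹`; then
  `K(a) = t·K(a₀ + a₁) + (1-t)·(K(a₀) + K(a₁))` (`kernelForm_succ`, `kernelForm_add`), the merged
  slice `a₀ + a₁` is supported on `S₀ ∪ S₁` with `|S₀ ∪ S₁| ≤ |S₀| + |S₁| = |S|`, and induction closes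
  with `A² ≤ s₀K₀, B² ≤ s₁K₁ ⇒ (A+B)² ≤ (s₀+s₁)(K₀+K₁)` (`sq_add_le`).
* §2 `norm_sq_sum_le_card_mul_re` — the Hermitian form for complex `b` (real and imaginary parts).
* §3 the one-qubit dictionary: `⟨+|+i⟩ = (1+i)/2`, `⟨T|+⟩ = (1+ω̄)/2`, `⟨T|+i⟩ = (1+ω)/2`
  (`ω = e^{iπ/4}`), and PHASE ABSORPTION `phase_absorb`:
  `⟨σ_b|T⟩⟨T|σ_{b'}⟩ t^{[b≠b']} = cos²(π/8) ⟨σ_b|σ_{b'}⟩`, `t = 2^{-1/2}` — the `T`-picture Gram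
  matrix is `t^{|x⊕y|}` conjugated by the diagonal unitary `diag(⟨T^{⊗n}|x̂⟩ / cos(π/8)^n)`.
* §4 `prodFamily`, `hatState`, `dotProduct_prodFamily` (`⟨σ(x)|τ(y)⟩ = Πᵢ⟨σ(xᵢ)|τ(yᵢ)⟩`),
  `phase_absorb_hatState`, and THEOREM 3: `norm_sq_overlap_le_card_mul`
  (`|⟨T^{⊗n}|φ⟩|² ≤ |S| cos(π/8)^{2n} ‖φ‖²` for `φ = Σ_{x∈S} a_x|x̂⟩`, any `a`) and the verbatim
  unit form `card_ge_overlap_sq_mul`.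
* §5 approximate decompositions (the tree's convention `normSq (ψ - φ) ≤ δ²` of
  `approxStabilizerRank`): Cauchy–Schwarz, `|⟨ψ|φ⟩| ≥ 1 - δ` (`‖ψ‖ = 1`) and `≥ 1 - δ²/2`
  (`‖ψ‖ = ‖φ‖ = 1`); hence `card_mul_normSq_ge_of_approx`: `(1-δ)² cos(π/8)^{-2n} ≤ |S|·‖φ‖²`, and
  `card_ge_of_approx_unit`: `(1-δ²/2)² cos(π/8)^{-2n} ≤ |S|` for unit `δ`-approximants in the span of
  `{|x̂⟩ : x ∈ S}`.
* §6 Bravyi–Gosset's Lemma 2 WITH ITS FIDELITY FACTOR (the landed `StabilizerFidelityMagicT` has the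
  case `ψ = T^{⊗n}`): for every `ψ = Σᵢ cᵢφᵢ` over stabilizer states,
  `|⟨T^{⊗n}|ψ⟩|² ≤ cos(π/8)^{2n} (Σ|cᵢ|)²` (`norm_sq_overlap_le_l1_sq`, by the landed `weak_duality` +
  `stabilizer_overlap_sq_le_cos`) and `|⟨T^{⊗n}|ψ⟩|² cos(π/8)^{-2n} ≤ k Σ|cᵢ|²`
  (`norm_sq_overlap_le_card_mul_l2` = "`χ ≥ ν^{-2t} f² ‖z‖^{-2}`"); δ-robust floors
  `l1_sq_ge_of_approx`, `card_mul_l2_ge_of_approx` (`f ≥ 1-δ`), numerically `≥ (1-δ)² 2^{0.2284 n}`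
  (`two_rpow_mul_le_inv_cos_pow`, from the landed `gamma_bounds`).

## Honest scope

A lower bound for decompositions of (approximations of) `T^{⊗n}` INSIDE the `2ⁿ` product states
`|x̂⟩` (§4–5), and `ℓ¹`/`ℓ²`-weighted bounds for arbitrary stabilizer dictionaries (§6). The
UNRESTRICTED δ-approximate rank of T^{⊗n} stays Ω̃(n²) (L-04: the tree's Mehraban–Tahmasbi floor,
`ApproxStabilizerRank*`) and the BG16 Ω(cos^{−2n}) conjecture stays OPEN (arXiv:1601.07601 Suppl. §5,
last paragraph) — neither is claimed; nor is anything about the exact rank beyond the tree's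
Peleg–Shpilka–Volk `Ω(n)`. Approximation convention BY NAME: the tree's `approxStabilizerRank`
(`StabilizerRank.lean`), `normSq (ψ - φ) ≤ δ ^ 2` with `φ` NOT normalised; `(1-δ)²` enters through
`|⟨T^{⊗n}|φ⟩| ≥ 1 - δ` (Cauchy–Schwarz, `one_sub_le_norm_dotProduct`). No simulation algorithm is built
or improved; nothing here proves or refutes quantum advantage (BQP vs BPP untouched).

References: [cite: BravyiEtAl2019, §2 Prop. 3, §5.4 Thm. 3, Lemma 8]; [cite: BravyiGosset2016,
Suppl. §5 Lemma 2]; Nielsen–Chuang 2010 §2.1, §4.2, §10.5 (folklore algebra: `|+i⟩ = S|+⟩`,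
Cauchy–Schwarz, tensor products of stabilizer states).
-/

noncomputable section

namespace Literature.Computability.QuantumComplexity.StabilizerFidelity.ProductFamily

open _root_.Computability Cryptography Matrix
open PelegShpilkaVolk
open scoped Classical

variable {n : ℕ}

/-- The kernel quadratic form `K_t(a) = Σ_{x,y} a(x) a(y) t^{d(x,y)}` on `ℝ^{𝔽₂ⁿ}`
(`d` = Hamming distance): the Gram form of Bravyi et al.'s matrix `G_{x,y} = t^{|x ⊕ y|}`.
[cite: BravyiEtAl2019, §5.4 Lemma 8 (the matrix `G_{i,j} = t^{|xⁱ⊕xʲ|}`)] -/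
def kernelForm (t : ℝ) (a : BVec n → ℝ) : ℝ :=
  ∑ x, ∑ y, a x * a y * t ^ hammingDist x y

/-- The mixed kernel form `X_t(a,a') = Σ_{x,y} a(x) a'(y) t^{d(x,y)}`. [folklore] -/
private def crossForm (t : ℝ) (a a' : BVec n → ℝ) : ℝ :=
  ∑ x, ∑ y, a x * a' y * t ^ hammingDist x y

/-- `X_t` is symmetric (`d(x,y) = d(y,x)`). [folklore] -/
private theorem crossForm_comm (t : ℝ) (a a' : BVec n → ℝ) : crossForm t a a' = crossForm t a' a := by
  unfold crossForm
  rw [Finset.sum_comm]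
  refine Finset.sum_congr rfl fun x _ => Finset.sum_congr rfl fun y _ => ?_
  rw [hammingDist_comm]; ring

/-- Bilinearity: `K(a + a') = K(a) + K(a') + 2X(a,a')`. [folklore] -/
private theorem kernelForm_add (t : ℝ) (a a' : BVec n → ℝ) :
    kernelForm t (a + a') = kernelForm t a + kernelForm t a' + 2 * crossForm t a a' := by
  have h : kernelForm t (a + a') = kernelForm t a + kernelForm t a' + crossForm t a a' + crossForm t a' a := by
    unfold kernelForm crossForm
    simp only [Pi.add_apply, ← Finset.sum_add_distrib]
    refine Finset.sum_congr rfl fun x _ => Finset.sum_congr rfl fun y _ => ?_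
    ring
  rw [h, crossForm_comm t a' a]; ring

/-- Hamming distance after prepending one coordinate. [folklore] -/
private theorem hammingDist_cons (b b' : ZMod 2) (x y : BVec n) :
    hammingDist (Fin.cons b x : BVec (n + 1)) (Fin.cons b' y) = (if b = b' then 0 else 1) + hammingDist x y := by
  simp only [hammingDist, Finset.card_filter]
  rw [Fin.sum_univ_succ]
  simp only [Fin.cons_zero, Fin.cons_succ]
  by_cases h : b = b' <;> simp [h]

/-- Splitting a sum over `𝔽₂ⁿ⁺¹` along the first coordinate. [folklore] -/
private theorem sum_split {M : Type*} [AddCommMonoid M] (g : BVec (n + 1) → M) :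
    ∑ v, g v = ∑ v' : BVec n, g (Fin.cons 0 v') + ∑ v' : BVec n, g (Fin.cons 1 v') := by
  have h3 : ∑ v, g v = ∑ p : ZMod 2 × BVec n, g (Fin.cons p.1 p.2) :=
    ((Fin.consEquiv fun _ : Fin (n + 1) => ZMod 2).sum_comp g).symm
  rw [h3, Fintype.sum_prod_type]
  exact Fin.sum_univ_two _

/-- The kernel form sliced along the first coordinate:
`K(a) = K(a₀) + K(a₁) + 2t·X(a₀,a₁)`. [folklore] -/
private theorem kernelForm_succ (t : ℝ) (a : BVec (n + 1) → ℝ) :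
    kernelForm t a = kernelForm t (fun v' => a (Fin.cons 0 v')) + kernelForm t (fun v' => a (Fin.cons 1 v'))
      + 2 * t * crossForm t (fun v' => a (Fin.cons 0 v')) (fun v' => a (Fin.cons 1 v')) := by
  have hne : (0 : ZMod 2) ≠ 1 := by decide
  -- the four blocks
  have blk : ∀ b b' : ZMod 2, ∑ x' : BVec n, ∑ y' : BVec n,
      a (Fin.cons b x') * a (Fin.cons b' y') * t ^ hammingDist (Fin.cons b x' : BVec (n + 1)) (Fin.cons b' y')
      = t ^ (if b = b' then 0 else 1) *
        ∑ x' : BVec n, ∑ y' : BVec n, a (Fin.cons b x') * a (Fin.cons b' y') * t ^ hammingDist x' y' := by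
    intro b b'
    rw [Finset.mul_sum]; refine Finset.sum_congr rfl fun x' _ => ?_
    rw [Finset.mul_sum]; refine Finset.sum_congr rfl fun y' _ => ?_
    rw [hammingDist_cons, pow_add]; ring
  have h00 := blk 0 0
  have h01 := blk 0 1
  have h10 := blk 1 0
  have h11 := blk 1 1
  rw [if_pos rfl, pow_zero, one_mul] at h00 h11
  rw [if_neg hne, pow_one] at h01
  rw [if_neg hne.symm, pow_one] at h10
  have hc := crossForm_comm t (fun v' => a (Fin.cons 1 v')) (fun v' => a (Fin.cons 0 v'))
  -- split the outer and inner sums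
  have hA : kernelForm t a = ∑ x' : BVec n, ∑ y, a (Fin.cons 0 x') * a y * t ^ hammingDist (Fin.cons 0 x' : BVec (n + 1)) y
      + ∑ x' : BVec n, ∑ y, a (Fin.cons 1 x') * a y * t ^ hammingDist (Fin.cons 1 x' : BVec (n + 1)) y :=
    sum_split _
  have hB : ∀ b : ZMod 2, ∑ x' : BVec n, ∑ y, a (Fin.cons b x') * a y * t ^ hammingDist (Fin.cons b x' : BVec (n + 1)) y
      = ∑ x' : BVec n, ∑ y' : BVec n, a (Fin.cons b x') * a (Fin.cons 0 y') * t ^ hammingDist (Fin.cons b x' : BVec (n + 1)) (Fin.cons 0 y')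
      + ∑ x' : BVec n, ∑ y' : BVec n, a (Fin.cons b x') * a (Fin.cons 1 y') * t ^ hammingDist (Fin.cons b x' : BVec (n + 1)) (Fin.cons 1 y') := by
    intro b
    rw [← Finset.sum_add_distrib]
    exact Finset.sum_congr rfl fun x' _ => sum_split _
  rw [hA, hB 0, hB 1, h00, h01, h10, h11]
  unfold kernelForm crossForm at hc ⊢
  beta_reduce at hc ⊢
  linear_combination t * hc

/-- The first-coordinate slices of `S ⊆ 𝔽₂ⁿ⁺¹`, as subsets of `𝔽₂ⁿ`. [folklore] -/
private def fiber (b : ZMod 2) (S : Finset (BVec (n + 1))) : Finset (BVec n) :=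
  Finset.univ.filter fun v' => (Fin.cons b v' : BVec (n + 1)) ∈ S

/-- Membership in a slice. [folklore] -/
private theorem mem_fiber {b : ZMod 2} {S : Finset (BVec (n + 1))} {v' : BVec n} :
    v' ∈ fiber b S ↔ (Fin.cons b v' : BVec (n + 1)) ∈ S := by
  simp [fiber]

/-- `|S₀| + |S₁| = |S|`. [folklore] -/
private theorem card_fiber_add (S : Finset (BVec (n + 1))) :
    (fiber 0 S).card + (fiber 1 S).card = S.card := by
  have h1 : S.card = ∑ v : BVec (n + 1), if v ∈ S then 1 else 0 := by simp
  have h2 : ∀ b : ZMod 2, (fiber b S).card = ∑ v' : BVec n, if (Fin.cons b v' : BVec (n + 1)) ∈ S then 1 else 0 := by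
    intro b; simp [fiber]
  rw [h1, h2, h2, sum_split]

/-- Two nonnegative reals whose product dominates `m²` have sum at least `2m`; packaged as the
"Engel form" `A² ≤ s₀K₀ → B² ≤ s₁K₁ → (A+B)² ≤ (s₀+s₁)(K₀+K₁)`. [folklore] -/
private theorem sq_add_le {s₀ s₁ K₀ K₁ A B : ℝ} (hs₀ : 0 ≤ s₀) (hs₁ : 0 ≤ s₁) (hK₀ : 0 ≤ K₀) (hK₁ : 0 ≤ K₁)
    (hA : A ^ 2 ≤ s₀ * K₀) (hB : B ^ 2 ≤ s₁ * K₁) : (A + B) ^ 2 ≤ (s₀ + s₁) * (K₀ + K₁) := by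
  -- the cross term: `2AB ≤ s₀K₁ + s₁K₀`
  have hcross : 2 * (A * B) ≤ s₀ * K₁ + s₁ * K₀ := by
    by_cases hAB : A * B ≤ 0
    · nlinarith [mul_nonneg hs₀ hK₁, mul_nonneg hs₁ hK₀]
    · push Not at hAB
      have hprod : (2 * (A * B)) ^ 2 ≤ (s₀ * K₁ + s₁ * K₀) ^ 2 := by
        have h4 : (A * B) ^ 2 ≤ (s₀ * K₀) * (s₁ * K₁) := by
          rw [mul_pow]; exact mul_le_mul hA hB (sq_nonneg _) (mul_nonneg hs₀ hK₀)
        nlinarith [sq_nonneg (s₀ * K₁ - s₁ * K₀)]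
      exact (pow_le_pow_iff_left₀ (by positivity) (by positivity) two_ne_zero).1 hprod
  nlinarith

/-- **Lemma 8 of Bravyi et al., quadratic-form version, with an elementary proof.** For every
`t ∈ [0,1]`, every `S ⊆ 𝔽₂ⁿ` and every real `a` supported in `S`:
`K_t(a) ≥ 0` and `(Σ_x a(x))² ≤ |S| · K_t(a)` — i.e. `𝟙ᵀ G_S⁻¹ 𝟙 ≤ |S|` for the principal
submatrix `G_S` of `(t^{|x⊕y|})`. Printed proof: `G` is a mixture over `S_n` of ultrametric
matrices, whose inverses are `Z`-matrices [MMM, Nabben–Varga], plus operator convexity of `x⁻¹`.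
Proof here: slice the first coordinate; `G_S = t·M + (1-t)·D` with `M` the kernel form of the
merged slices (`a₀ + a₁` on `S₀ ∪ S₁ ⊆ 𝔽₂ⁿ⁻¹`, `|S₀ ∪ S₁| ≤ |S|`) and `D` the two slices
separately; induct. [cite: BravyiEtAl2019, §5.4 Lemma 8 (eq. `Σᵢⱼ (G⁻¹)ᵢⱼ ≤ χ`); this file's proof differs] -/
theorem kernelForm_nonneg_and_sq_sum_le {t : ℝ} (ht0 : 0 ≤ t) (ht1 : t ≤ 1) :
    ∀ {n : ℕ} (S : Finset (BVec n)) (a : BVec n → ℝ), (∀ x, x ∉ S → a x = 0) →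
      0 ≤ kernelForm t a ∧ (∑ x, a x) ^ 2 ≤ S.card * kernelForm t a := by
  intro n
  induction n with
  | zero =>
    intro S a ha
    have hK : kernelForm t a = a 0 * a 0 := by
      unfold kernelForm
      rw [Fintype.sum_subsingleton _ (0 : BVec 0), Fintype.sum_subsingleton _ (0 : BVec 0), hammingDist_self,
        pow_zero, mul_one]
    have hsum : ∑ x, a x = a 0 := Fintype.sum_subsingleton _ _
    rw [hK, hsum]
    refine ⟨mul_self_nonneg _, ?_⟩
    by_cases h0 : (0 : BVec 0) ∈ S
    · have hc : (1 : ℝ) ≤ S.card := by exact_mod_cast Finset.card_pos.2 ⟨0, h0⟩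
      nlinarith [mul_self_nonneg (a 0)]
    · rw [ha 0 h0]; simp
  | succ n ih =>
    intro S a ha
    set a₀ : BVec n → ℝ := fun v' => a (Fin.cons 0 v') with ha₀
    set a₁ : BVec n → ℝ := fun v' => a (Fin.cons 1 v') with ha₁
    have hsupp₀ : ∀ x, x ∉ fiber 0 S → a₀ x = 0 := fun x hx => ha _ (mt mem_fiber.2 hx)
    have hsupp₁ : ∀ x, x ∉ fiber 1 S → a₁ x = 0 := fun x hx => ha _ (mt mem_fiber.2 hx)
    have hsuppU : ∀ x, x ∉ fiber 0 S ∪ fiber 1 S → (a₀ + a₁) x = 0 := by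
      intro x hx
      rw [Finset.mem_union, not_or] at hx
      simp [hsupp₀ x hx.1, hsupp₁ x hx.2]
    obtain ⟨hK₀, hA⟩ := ih (fiber 0 S) a₀ hsupp₀
    obtain ⟨hK₁, hB⟩ := ih (fiber 1 S) a₁ hsupp₁
    obtain ⟨hKU, hU⟩ := ih (fiber 0 S ∪ fiber 1 S) (a₀ + a₁) hsuppU
    have hsumU : ∑ x, (a₀ + a₁) x = ∑ x, a₀ x + ∑ x, a₁ x := by
      simp [Finset.sum_add_distrib]
    have hcardU : ((fiber 0 S ∪ fiber 1 S).card : ℝ) ≤ S.card := by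
      exact_mod_cast (Finset.card_union_le _ _).trans (card_fiber_add S).le
    have hcardS : (S.card : ℝ) = (fiber 0 S).card + (fiber 1 S).card := by
      exact_mod_cast (card_fiber_add S).symm
    have hsum : ∑ x, a x = ∑ x, a₀ x + ∑ x, a₁ x := sum_split a
    have hKsucc : kernelForm t a = kernelForm t a₀ + kernelForm t a₁ + 2 * t * crossForm t a₀ a₁ :=
      kernelForm_succ t a
    have hKadd : kernelForm t (a₀ + a₁) = kernelForm t a₀ + kernelForm t a₁ + 2 * crossForm t a₀ a₁ :=
      kernelForm_add t a₀ a₁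
    -- the convex split `K(a) = t·K(a₀+a₁) + (1-t)·(K(a₀) + K(a₁))`
    have hsplit : kernelForm t a = t * kernelForm t (a₀ + a₁) + (1 - t) * (kernelForm t a₀ + kernelForm t a₁) := by
      rw [hKsucc, hKadd]; ring
    refine ⟨?_, ?_⟩
    · rw [hsplit]
      have : 0 ≤ 1 - t := sub_nonneg.2 ht1
      positivity
    · -- M-part and D-part
      have hM : t * (∑ x, a₀ x + ∑ x, a₁ x) ^ 2 ≤ t * (S.card * kernelForm t (a₀ + a₁)) := by
        refine mul_le_mul_of_nonneg_left ?_ ht0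
        rw [← hsumU]
        exact hU.trans (mul_le_mul_of_nonneg_right hcardU hKU)
      have hD : (1 - t) * (∑ x, a₀ x + ∑ x, a₁ x) ^ 2 ≤
          (1 - t) * (S.card * (kernelForm t a₀ + kernelForm t a₁)) := by
        refine mul_le_mul_of_nonneg_left ?_ (sub_nonneg.2 ht1)
        rw [hcardS]
        exact sq_add_le (Nat.cast_nonneg _) (Nat.cast_nonneg _) hK₀ hK₁ hA hB
      rw [hsum, hsplit]
      nlinarith [hM, hD]

/-- The kernel inequality for finitely supported real vectors, matrix-free form of
`𝟙ᵀG⁻¹𝟙 ≤ χ`: `(Σ_{x∈S} a(x))² ≤ |S|·Σ_{x,y∈S} a(x)a(y) t^{d(x,y)}`, all `t ∈ [0,1]`.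
[cite: BravyiEtAl2019, §5.4 Lemma 8; this file's proof differs] -/
theorem sq_sum_le_card_mul_kernel {t : ℝ} (ht0 : 0 ≤ t) (ht1 : t ≤ 1) (S : Finset (BVec n)) (a : BVec n → ℝ) :
    (∑ x ∈ S, a x) ^ 2 ≤ S.card * ∑ x ∈ S, ∑ y ∈ S, a x * a y * t ^ hammingDist x y := by
  set a' : BVec n → ℝ := fun x => if x ∈ S then a x else 0 with ha'
  have hsupp : ∀ x, x ∉ S → a' x = 0 := fun x hx => by simp [ha', hx]
  have h := (kernelForm_nonneg_and_sq_sum_le ht0 ht1 S a' hsupp).2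
  have hs : ∑ x, a' x = ∑ x ∈ S, a x := by
    simp only [ha']
    rw [Finset.sum_ite_mem, Finset.univ_inter]
  have hK : kernelForm t a' = ∑ x ∈ S, ∑ y ∈ S, a x * a y * t ^ hammingDist x y := by
    unfold kernelForm
    rw [← Finset.sum_subset (Finset.subset_univ S)]
    · refine Finset.sum_congr rfl fun x hx => ?_
      rw [← Finset.sum_subset (Finset.subset_univ S)]
      · refine Finset.sum_congr rfl fun y hy => ?_
        simp [ha', hx, hy]
      · intro y _ hy; simp [ha', hy]
    · intro x _ hx; simp [ha', hx]
  rw [← hs, ← hK]; exact h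


/-! ### §2 The complex kernel form -/

/-- **Complex (Hermitian) kernel inequality**: for `b : 𝔽₂ⁿ → ℂ` supported in `S` and `t ∈ [0,1]`,
`|Σ_x b(x)|² ≤ |S| · Re Σ_{x,y} b̄(x) b(y) t^{d(x,y)}` — the real inequality applied to `Re b` and
`Im b` (the kernel is real symmetric). [cite: BravyiEtAl2019, §5.4 Lemma 8; this file's proof differs] -/
theorem norm_sq_sum_le_card_mul_re {t : ℝ} (ht0 : 0 ≤ t) (ht1 : t ≤ 1) (S : Finset (BVec n))
    (b : BVec n → ℂ) (hb : ∀ x, x ∉ S → b x = 0) :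
    ‖∑ x, b x‖ ^ 2 ≤ S.card * (∑ x, ∑ y, star (b x) * b y * (t : ℂ) ^ hammingDist x y).re := by
  have hre := (kernelForm_nonneg_and_sq_sum_le ht0 ht1 S (fun x => (b x).re)
    (fun x hx => by simp [hb x hx])).2
  have him := (kernelForm_nonneg_and_sq_sum_le ht0 ht1 S (fun x => (b x).im)
    (fun x hx => by simp [hb x hx])).2
  have h1 : ‖∑ x, b x‖ ^ 2 = (∑ x, (b x).re) ^ 2 + (∑ x, (b x).im) ^ 2 := by
    rw [Complex.sq_norm, Complex.normSq_apply, Complex.re_sum, Complex.im_sum]; ring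
  have h2 : (∑ x, ∑ y, star (b x) * b y * (t : ℂ) ^ hammingDist x y).re
      = kernelForm t (fun x => (b x).re) + kernelForm t (fun x => (b x).im) := by
    unfold kernelForm
    rw [← Finset.sum_add_distrib, Complex.re_sum]
    refine Finset.sum_congr rfl fun x _ => ?_
    rw [← Finset.sum_add_distrib, Complex.re_sum]
    refine Finset.sum_congr rfl fun y _ => ?_
    rw [← Complex.ofReal_pow, Complex.mul_re, Complex.ofReal_re, Complex.ofReal_im, mul_zero, sub_zero,
      Complex.mul_re, Complex.star_def, Complex.conj_re, Complex.conj_im]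
    ring
  rw [h1, h2, mul_add]
  exact add_le_add hre him

/-! ### §3 The one-qubit dictionary `|+⟩, |+i⟩` against `|T⟩` -/

/-- `|+i⟩ = S|+⟩ = (|0⟩ + i|1⟩)/√2`, the second state of the product dictionary (the
`T`-picture image of Bravyi et al.'s `|+⟩ = |1̃⟩`; `|+⟩` itself is the image of `|0̃⟩ = |0⟩`).
[cite: BravyiEtAl2019, §5.4 (the states `|x̃⟩`, `|0̃⟩ = |0⟩`, `|1̃⟩ = |+⟩`)] -/
def plusIState : QReg 1 → ℂ := sGate *ᵥ plusState

/-- `|+i⟩ = S H|0⟩` is a stabilizer state (tree: `plusIState_mem_stabilizerStates`).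
[cite: NielsenChuang2010, §10.5.1 (stabilizer states: Clifford images of `|0⟩`)] -/
theorem plusIState_mem : plusIState ∈ stabilizerStates 1 := plusIState_mem_stabilizerStates

/-- `|+⟩ = (1/√2, 1/√2)`. [folklore] -/
private theorem plusState_apply (y : QReg 1) : plusState y = invSqrt2 := by
  unfold plusState; rw [CliffordSim.hGate_mulVec_zeroState]

/-- `|+i⟩ = (1/√2, i/√2)`. [folklore] -/
private theorem plusIState_apply (y : QReg 1) :
    plusIState y = (if y 0 = true then Complex.I else 1) * invSqrt2 := by
  unfold plusIState; rw [sGate_mulVec_apply, plusState_apply]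

/-- `⟨u|v⟩` on one qubit, written out. [folklore] -/
private theorem dotProduct_qReg_one (u v : QReg 1 → ℂ) :
    star u ⬝ᵥ v = star (u fun _ => false) * v (fun _ => false) + star (u fun _ => true) * v fun _ => true := by
  simp only [dotProduct, Pi.star_apply]
  rw [sum_qReg_one, Fintype.sum_bool, add_comm]

/-- `1/√2` is real. [folklore] -/
private theorem star_invSqrt2' : star (invSqrt2 : ℂ) = invSqrt2 := by simp [invSqrt2]

/-- `(1/√2)² = 1/2`. [folklore] -/
private theorem invSqrt2_sq' : (invSqrt2 : ℂ) * invSqrt2 = 1 / 2 := invSqrt2_mul_invSqrt2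

/-- `(√2)² = 2` in `ℂ`. [folklore] -/
private theorem sqrt2C_sq : (Real.sqrt 2 : ℂ) ^ 2 = 2 := by
  rw [← Complex.ofReal_pow, Real.sq_sqrt (by norm_num : (0 : ℝ) ≤ 2)]; push_cast; ring

/-- `1/√2 = √2/2` in `ℂ`. [folklore] -/
private theorem invSqrt2_eq_half_sqrt2 : (invSqrt2 : ℂ) = (Real.sqrt 2 : ℂ) / 2 := by
  have hs0 : (Real.sqrt 2 : ℂ) ≠ 0 := by
    intro h
    have := sqrt2C_sq
    rw [h] at this; norm_num at this
  show (1 / (Real.sqrt 2 : ℂ)) = _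
  rw [div_eq_div_iff hs0 two_ne_zero, one_mul, ← sq, sqrt2C_sq]

/-- `ω̄ = √2/2 - i√2/2`. [folklore] -/
private theorem star_omega_eq_sqrt :
    star omega = ((Real.sqrt 2 / 2 : ℝ) : ℂ) - ((Real.sqrt 2 / 2 : ℝ) : ℂ) * Complex.I := by
  apply Complex.ext <;> simp [omega_re, omega_im]

/-- `ω̄ · i = ω`. [folklore] -/
private theorem star_omega_mul_I : star omega * Complex.I = omega := by
  apply Complex.ext <;> simp [omega_re, omega_im]

/-- `C² = (2+√2)/4`. [folklore] -/
private theorem cosT_sq'' : cosT ^ 2 = (2 + Real.sqrt 2) / 4 := by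
  unfold cosT
  rw [norm_div, div_pow, norm_one_add_omega_sq]
  norm_num

/-- `z̄ z = |z|²`. [folklore] -/
private theorem star_mul_self_eq (z : ℂ) : star z * z = ((‖z‖ ^ 2 : ℝ) : ℂ) := by
  rw [Complex.star_def, mul_comm, Complex.mul_conj, Complex.normSq_eq_norm_sq]

/-- `⟨+|+⟩ = 1`. [folklore] -/
private theorem dotProduct_plusState_self : star plusState ⬝ᵥ plusState = 1 := by
  rw [← ofReal_normSq_eq_dotProduct, show normSq plusState = 1 from normSq_plusState, Complex.ofReal_one]

/-- `⟨+i|+i⟩ = 1`. [folklore] -/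
private theorem dotProduct_plusIState_self : star plusIState ⬝ᵥ plusIState = 1 := by
  rw [← ofReal_normSq_eq_dotProduct, show normSq plusIState = 1 from normSq_plusIState, Complex.ofReal_one]

/-- `⟨+|+i⟩ = (1+i)/2` (modulus `2^{-1/2} = t`, the `T`-picture of `⟨0|+⟩ = 2^{-1/2}`).
[cite: BravyiEtAl2019, §5.4 (`G_{i,j} = ⟨x̃ⁱ|x̃ʲ⟩ = t^{|xⁱ⊕xʲ|}`, `t = 2^{-1/2}`)] -/
theorem dotProduct_plusState_plusIState : star plusState ⬝ᵥ plusIState = (1 + Complex.I) / 2 := by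
  rw [dotProduct_qReg_one]
  simp only [plusState_apply, plusIState_apply, if_true, Bool.false_eq_true, if_false, one_mul,
    star_invSqrt2']
  linear_combination (1 + Complex.I) * invSqrt2_sq'

/-- `⟨+i|+⟩ = (1-i)/2`. [cite: BravyiEtAl2019, §5.4 (`G_{i,j} = t^{|xⁱ⊕xʲ|}`)] -/
theorem dotProduct_plusIState_plusState : star plusIState ⬝ᵥ plusState = (1 - Complex.I) / 2 := by
  rw [dotProduct_qReg_one]
  simp only [plusState_apply, plusIState_apply, if_true, Bool.false_eq_true, if_false, one_mul,
    star_mul', star_invSqrt2', Complex.star_def, Complex.conj_I]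
  linear_combination (1 - Complex.I) * invSqrt2_sq'

/-- `⟨T|+⟩ = (1+ω̄)/2` (modulus `cos(π/8)`). [cite: BravyiEtAl2019, §5.4 (`⟨x̃|H^{⊗n}⟩ = cos(π/8)^n`)] -/
theorem dotProduct_magicT_plusState : star magicT ⬝ᵥ plusState = (1 + star omega) / 2 := by
  rw [dotProduct_qReg_one]
  simp only [plusState_apply, CliffordSim.magicT_apply, if_true, Bool.false_eq_true, if_false, mul_one,
    star_mul', star_invSqrt2']
  linear_combination (1 + star omega) * invSqrt2_sq'

/-- `⟨T|+i⟩ = (1+ω)/2` (modulus `cos(π/8)`; uses `ω̄ i = ω`).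
[cite: BravyiEtAl2019, §5.4 (`⟨x̃|H^{⊗n}⟩ = cos(π/8)^n`)] -/
theorem dotProduct_magicT_plusIState : star magicT ⬝ᵥ plusIState = (1 + omega) / 2 := by
  rw [dotProduct_qReg_one]
  simp only [plusIState_apply, CliffordSim.magicT_apply, if_true, Bool.false_eq_true, if_false, mul_one,
    one_mul, star_mul', star_invSqrt2']
  linear_combination (1 + omega) * invSqrt2_sq' + ((invSqrt2 : ℂ) * invSqrt2) * star_omega_mul_I

/-- The product dictionary of Bravyi–Gosset / Bravyi et al. in the `T`-picture:
bit `0 ↦ |+⟩`, bit `1 ↦ |+i⟩`. [cite: BravyiEtAl2019, §5.4 (`|0̃⟩ = |0⟩`, `|1̃⟩ = |+⟩`)] -/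
def sigmaT (b : ZMod 2) : QReg 1 → ℂ := if b = 0 then plusState else plusIState

/-- Both dictionary states are stabilizer states. [cite: BravyiEtAl2019, §5.4 (the `|x̃⟩` are
stabilizer states)] -/
theorem sigmaT_mem (b : ZMod 2) : sigmaT b ∈ stabilizerStates 1 := by
  unfold sigmaT; split_ifs
  · exact plusState_mem_stabilizerStates
  · exact plusIState_mem

/-- `𝔽₂ = {0, 1}`. [folklore] -/
private theorem zmod2_cases (b : ZMod 2) : b = 0 ∨ b = 1 := by
  revert b; decide

/-- `σ_T(0) = |+⟩`. [cite: BravyiEtAl2019, §5.4 (`|0̃⟩ = |0⟩`)] -/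
@[simp] theorem sigmaT_zero : sigmaT 0 = plusState := if_pos rfl

/-- `σ_T(1) = |+i⟩`. [cite: BravyiEtAl2019, §5.4 (`|1̃⟩ = |+⟩`)] -/
@[simp] theorem sigmaT_one : sigmaT 1 = plusIState := if_neg (by decide)

/-- `star((1+ω)/2) = (1+ω̄)/2`. [folklore] -/
private theorem star_alpha : star ((1 + omega) / 2 : ℂ) = (1 + star omega) / 2 := by
  rw [star_div₀, star_add, star_one, star_ofNat]

/-- **Phase absorption** (one qubit): `⟨σ_b|T⟩⟨T|σ_{b'}⟩ · t^{[b≠b']} = cos²(π/8) · ⟨σ_b|σ_{b'}⟩`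
with `t = 2^{-1/2}` — the `T`-picture Gram matrix differs from `t^{|x⊕y|}` exactly by the
diagonal unitary gauge `D = diag(⟨T|σ_b⟩/cos(π/8))`. [cite: BravyiEtAl2019, §5.4 (proof of Thm. 3:
`⟨x̃|H^{⊗n}⟩ = cos(π/8)^n`, `G_{i,j} = t^{|xⁱ⊕xʲ|}`)] -/
theorem phase_absorb (b b' : ZMod 2) :
    star (star magicT ⬝ᵥ sigmaT b) * (star magicT ⬝ᵥ sigmaT b') *
        (if b = b' then 1 else ((1 / Real.sqrt 2 : ℝ) : ℂ))
      = ((cosT ^ 2 : ℝ) : ℂ) * (star (sigmaT b) ⬝ᵥ sigmaT b') := by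
  have ht : ((1 / Real.sqrt 2 : ℝ) : ℂ) = (Real.sqrt 2 : ℂ) / 2 := by
    rw [← invSqrt2_eq_half_sqrt2]; push_cast; rfl
  have hc : ((cosT ^ 2 : ℝ) : ℂ) = (2 + (Real.sqrt 2 : ℂ)) / 4 := by
    rw [cosT_sq'']; push_cast; ring
  have h01 : (0 : ZMod 2) ≠ 1 := by decide
  rcases zmod2_cases b with rfl | rfl <;> rcases zmod2_cases b' with rfl | rfl
  · -- (0,0): `|⟨T|+⟩|² = C²`, `⟨+|+⟩ = 1`
    rw [if_pos rfl, mul_one, sigmaT_zero, dotProduct_magicT_plusState, dotProduct_plusState_self, mul_one,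
      star_mul_self_eq, ← star_alpha, norm_star]
    rfl
  · -- (0,1): `((1+ω)/2)²·(√2/2) = C²·(1+i)/2`
    rw [if_neg h01, sigmaT_zero, sigmaT_one, dotProduct_magicT_plusState, dotProduct_magicT_plusIState,
      dotProduct_plusState_plusIState, ht, hc, ← star_alpha, star_star, omega_eq_sqrt]
    push_cast
    linear_combination ((1 + Complex.I) / 8 + (Real.sqrt 2 : ℂ) * Complex.I / 16) * sqrt2C_sq
      + ((Real.sqrt 2 : ℂ) ^ 3 / 32) * Complex.I_sq
  · -- (1,0): the complex conjugate of (0,1)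
    rw [if_neg h01.symm, sigmaT_zero, sigmaT_one, dotProduct_magicT_plusState,
      dotProduct_magicT_plusIState, dotProduct_plusIState_plusState, ht, hc, star_alpha,
      star_omega_eq_sqrt]
    push_cast
    linear_combination ((1 - Complex.I) / 8 - (Real.sqrt 2 : ℂ) * Complex.I / 16) * sqrt2C_sq
      + ((Real.sqrt 2 : ℂ) ^ 3 / 32) * Complex.I_sq
  · -- (1,1): `|⟨T|+i⟩|² = C²`, `⟨+i|+i⟩ = 1`
    rw [if_pos rfl, mul_one, sigmaT_one, dotProduct_magicT_plusIState, dotProduct_plusIState_self, mul_one,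
      star_mul_self_eq]
    rfl

/-! ### §4 Product families and Theorem 3 -/

/-- The product family `x ↦ σ(x₁) ⊗ ⋯ ⊗ σ(xₙ)` over a one-qubit dictionary `σ`, built by appending
the last qubit (matching the tree's `tensorPow`). [cite: BravyiEtAl2019, §5.4 (`|x̃⟩ = ⊗ᵢ|x̃ᵢ⟩`)] -/
def prodFamily (σ : ZMod 2 → QReg 1 → ℂ) : (n : ℕ) → BVec n → QReg n → ℂ
  | 0, _ => fun _ => 1
  | n + 1, x => tensorVec (prodFamily σ n (Fin.init x)) (σ (x (Fin.last n)))

/-- A constant dictionary gives the tensor power `ψ^{⊗n}`. [cite: BravyiEtAl2019, §5.4 (`H^{⊗n}`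
against the `|x̃⟩`)] -/
theorem prodFamily_const (ψ : QReg 1 → ℂ) : ∀ (n : ℕ) (x : BVec n), prodFamily (fun _ => ψ) n x = tensorPow ψ n
  | 0, _ => rfl
  | n + 1, x => by rw [prodFamily, tensorPow, prodFamily_const ψ n]

/-- Product families of stabilizer states are stabilizer states.
[cite: NielsenChuang2010, §10.5.1 (tensor products of stabilizer states)] -/
theorem prodFamily_mem {σ : ZMod 2 → QReg 1 → ℂ} (hσ : ∀ b, σ b ∈ stabilizerStates 1) :
    ∀ (n : ℕ) (x : BVec n), prodFamily σ n x ∈ stabilizerStates n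
  | 0, x => by
    rw [show prodFamily σ 0 x = tensorPow plusState 0 from rfl, tensorPow_zero_eq_zeroState]
    exact zeroState_mem_stabilizerStates 0
  | n + 1, x => by
    rw [prodFamily]
    exact tensorVec_mem_stabilizerStates (prodFamily_mem hσ n _) (hσ _)

/-- **Inner products of product families multiply coordinatewise**:
`⟨σ(x)|τ(y)⟩ = Πᵢ ⟨σ(xᵢ)|τ(yᵢ)⟩`. [cite: BravyiEtAl2019, §5.4 (`⟨x̃ⁱ|x̃ʲ⟩ = t^{|xⁱ⊕xʲ|}`)] -/
theorem dotProduct_prodFamily (σ τ : ZMod 2 → QReg 1 → ℂ) : ∀ (n : ℕ) (x y : BVec n),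
    star (prodFamily σ n x) ⬝ᵥ prodFamily τ n y = ∏ i, (star (σ (x i)) ⬝ᵥ τ (y i))
  | 0, x, y => by
    rw [show prodFamily σ 0 x = fun _ => 1 from rfl, show prodFamily τ 0 y = fun _ => 1 from rfl]
    simp [dotProduct]
  | n + 1, x, y => by
    rw [prodFamily, prodFamily, dotProduct_tensorVec, dotProduct_prodFamily σ τ n, Fin.prod_univ_castSucc]
    rfl

/-- The states `|x̂⟩ = ⊗ᵢ σ_T(xᵢ)`, `x ∈ 𝔽₂ⁿ` (`σ_T(0) = |+⟩`, `σ_T(1) = |+i⟩`): the `T`-picture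
of the family `|x̃⟩` of Bravyi–Gosset / Bravyi et al. [cite: BravyiEtAl2019, §5.4 (`|x̃⟩`)] -/
def hatState (n : ℕ) (x : BVec n) : QReg n → ℂ := prodFamily sigmaT n x

/-- Each `|x̂⟩` is a stabilizer state. [cite: BravyiEtAl2019, §5.4] -/
theorem hatState_mem (x : BVec n) : hatState n x ∈ stabilizerStates n := prodFamily_mem sigmaT_mem n x

/-- `t^{d(x,y)} = Πᵢ t^{[xᵢ≠yᵢ]}`. [folklore] -/
private theorem pow_hammingDist_eq_prod {R : Type*} [CommMonoid R] (t : R) (x y : BVec n) :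
    t ^ hammingDist x y = ∏ i, (if x i = y i then 1 else t) := by
  unfold hammingDist
  rw [← Finset.prod_const, Finset.prod_filter]
  refine Finset.prod_congr rfl fun i _ => ?_
  by_cases h : x i = y i <;> simp [h]

/-- **Phase absorption for the family**: `⟨x̂|T^{⊗n}⟩⟨T^{⊗n}|ŷ⟩ · t^{d(x,y)} = cos(π/8)^{2n} ⟨x̂|ŷ⟩`.
[cite: BravyiEtAl2019, §5.4 (proof of Thm. 3)] -/
theorem phase_absorb_hatState (x y : BVec n) :
    star (star (tensorPow magicT n) ⬝ᵥ hatState n x) * (star (tensorPow magicT n) ⬝ᵥ hatState n y) *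
        ((1 / Real.sqrt 2 : ℝ) : ℂ) ^ hammingDist x y
      = ((cosT ^ 2 : ℝ) : ℂ) ^ n * (star (hatState n x) ⬝ᵥ hatState n y) := by
  unfold hatState
  rw [← prodFamily_const magicT n x, dotProduct_prodFamily, prodFamily_const, ← prodFamily_const magicT n y,
    dotProduct_prodFamily, dotProduct_prodFamily, star_prod, pow_hammingDist_eq_prod,
    ← Finset.prod_mul_distrib, ← Finset.prod_mul_distrib,
    Finset.prod_congr rfl fun i _ => phase_absorb (x i) (y i), Finset.prod_mul_distrib, Finset.prod_const,
    Finset.card_univ, Fintype.card_fin]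

/-- `⟨Σ aₓ Xₓ | Σ a_y X_y⟩ = Σₓ Σ_y āₓ a_y ⟨Xₓ|X_y⟩`. [folklore] -/
private theorem dotProduct_sum_smul_self {ι : Type*} [Fintype ι] (a : ι → ℂ) (X : ι → QReg n → ℂ) :
    star (∑ x, a x • X x) ⬝ᵥ (∑ y, a y • X y) = ∑ x, ∑ y, star (a x) * a y * (star (X x) ⬝ᵥ X y) := by
  rw [star_sum, sum_dotProduct]
  refine Finset.sum_congr rfl fun x _ => ?_
  rw [star_smul, smul_dotProduct, dotProduct_sum, smul_eq_mul, Finset.mul_sum]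
  refine Finset.sum_congr rfl fun y _ => ?_
  rw [dotProduct_smul, smul_eq_mul]
  ring

/-- **Theorem 3 of Bravyi–Browne–Calpin–Campbell–Gosset–Howard (homogeneous `T`-picture form).**
For every `S ⊆ 𝔽₂ⁿ` and every `φ = Σ_{x∈S} a_x |x̂⟩` in the span of the product stabilizer states
`|x̂⟩`, `x ∈ S`:  `|⟨T^{⊗n}|φ⟩|² ≤ |S| · cos(π/8)^{2n} · ‖φ‖²`. Proof: phase absorption turns the
Gram form into the kernel form `t^{d(x,y)}` and `⟨T^{⊗n}|φ⟩` into `cos(π/8)^n Σ b_x`; then §1–2.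
Scope (F-a): a bound for the RESTRICTED dictionary `{|x̂⟩}` only — the UNRESTRICTED δ-approximate
rank of T^{⊗n} stays Ω̃(n²) (L-04) and the BG16 Ω(cos^{−2n}) conjecture stays OPEN.
[cite: BravyiEtAl2019, §5.4 Theorem 3 (= Prop. 3); kernel step by this file's Lemma 8 proof] -/
theorem norm_sq_overlap_le_card_mul (S : Finset (BVec n)) (a : BVec n → ℂ) (ha : ∀ x, x ∉ S → a x = 0) :
    ‖star (tensorPow magicT n) ⬝ᵥ (∑ x, a x • hatState n x)‖ ^ 2
      ≤ S.card * ((Real.cos (Real.pi / 8) ^ 2) ^ n * normSq (∑ x, a x • hatState n x)) := by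
  set φ := ∑ x, a x • hatState n x with hφ
  set b : BVec n → ℂ := fun x => a x * (star (tensorPow magicT n) ⬝ᵥ hatState n x) with hb
  have hbs : ∀ x, x ∉ S → b x = 0 := fun x hx => by simp [hb, ha x hx]
  have hov : star (tensorPow magicT n) ⬝ᵥ φ = ∑ x, b x := by
    rw [hφ, dotProduct_sum]
    refine Finset.sum_congr rfl fun x _ => ?_
    rw [dotProduct_smul, smul_eq_mul]
  have ht0 : (0 : ℝ) ≤ 1 / Real.sqrt 2 := by positivity
  have ht1 : 1 / Real.sqrt 2 ≤ (1 : ℝ) := by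
    rw [div_le_one (by positivity)]
    exact Real.one_le_sqrt.2 (by norm_num)  -- 1 ≤ √2
  have hK := norm_sq_sum_le_card_mul_re ht0 ht1 S b hbs
  have hker : ∑ x, ∑ y, star (b x) * b y * (((1 / Real.sqrt 2 : ℝ)) : ℂ) ^ hammingDist x y
      = ((cosT ^ 2 : ℝ) : ℂ) ^ n * (star φ ⬝ᵥ φ) := by
    rw [hφ, dotProduct_sum_smul_self, Finset.mul_sum]
    refine Finset.sum_congr rfl fun x _ => ?_
    rw [Finset.mul_sum]
    refine Finset.sum_congr rfl fun y _ => ?_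
    have h := phase_absorb_hatState x y
    simp only [hb, star_mul']
    linear_combination (star (a x) * a y) * h
  rw [hov]
  refine hK.trans (le_of_eq ?_)
  rw [hker, ← ofReal_normSq_eq_dotProduct, ← Complex.ofReal_pow, ← Complex.ofReal_mul, Complex.ofReal_re,
    cosT_sq_eq_cos_sq]

/-- **Theorem 3 / Proposition 3 of Bravyi et al., verbatim (unit `φ`)**: if `φ` is a unit vector in
the span of `{|x̂⟩ : x ∈ S}` then `|S| ≥ |⟨T^{⊗n}|φ⟩|² · cos(π/8)^{-2n}`.
[cite: BravyiEtAl2019, §5.4 Theorem 3 (`|S| ≥ |⟨H^{⊗n}|φ⟩|² cos(π/8)^{-2n}`), §2 Prop. 3] -/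
theorem card_ge_overlap_sq_mul (S : Finset (BVec n)) (a : BVec n → ℂ) (ha : ∀ x, x ∉ S → a x = 0)
    (hunit : normSq (∑ x, a x • hatState n x) = 1) :
    ‖star (tensorPow magicT n) ⬝ᵥ (∑ x, a x • hatState n x)‖ ^ 2 * ((Real.cos (Real.pi / 8) ^ 2) ^ n)⁻¹
      ≤ S.card := by
  have hc : 0 < (Real.cos (Real.pi / 8) ^ 2) ^ n := pow_pos (by
    have := cos_sq_pi_div_eight_bounds.1; linarith) n
  have h := norm_sq_overlap_le_card_mul S a ha
  rw [hunit, mul_one] at h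
  rw [← div_eq_mul_inv, div_le_iff₀ hc]
  exact h


/-! ### §5 Approximate decompositions: the Cauchy–Schwarz step and the δ-robust floors -/

/-- Cauchy–Schwarz: `|⟨u|v⟩|² ≤ ‖u‖²‖v‖²`. [cite: NielsenChuang2010, §2.1.4 Box 2.1 (Cauchy–Schwarz
inequality)] -/
theorem norm_sq_dotProduct_le_normSq_mul (u v : QReg n → ℂ) :
    ‖star u ⬝ᵥ v‖ ^ 2 ≤ normSq u * normSq v := by
  have h1 := norm_dotProduct_le u v
  have h2 : (∑ x, ‖u x‖ * ‖v x‖) ^ 2 ≤ (∑ x, ‖u x‖ ^ 2) * ∑ x, ‖v x‖ ^ 2 :=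
    Finset.sum_mul_sq_le_sq_mul_sq _ _ _
  exact (pow_le_pow_left₀ (norm_nonneg _) h1 2).trans h2

/-- **Fidelity from distance**: if `‖ψ‖ = 1` and `‖ψ - φ‖ ≤ δ` then `|⟨ψ|φ⟩| ≥ 1 - δ`
(`⟨ψ|φ⟩ = 1 - ⟨ψ|ψ-φ⟩` and Cauchy–Schwarz). [cite: BravyiGosset2016, Suppl. §5 Lemma 2
(hypothesis `|⟨ψ|H^{⊗t}⟩| ≥ f`; here `f = 1 - δ` for a `δ`-approximation)] -/
theorem one_sub_le_norm_dotProduct {ψ φ : QReg n → ℂ} (hψ : normSq ψ = 1) {δ : ℝ} (hδ : 0 ≤ δ)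
    (happ : normSq (ψ - φ) ≤ δ ^ 2) : 1 - δ ≤ ‖star ψ ⬝ᵥ φ‖ := by
  have hcs := norm_sq_dotProduct_le_normSq_mul ψ (ψ - φ)
  rw [hψ, one_mul] at hcs
  have hd : ‖star ψ ⬝ᵥ (ψ - φ)‖ ≤ δ :=
    (pow_le_pow_iff_left₀ (norm_nonneg _) hδ two_ne_zero).1 (hcs.trans happ)
  have heq : star ψ ⬝ᵥ φ = 1 - star ψ ⬝ᵥ (ψ - φ) := by
    rw [dotProduct_sub, ← ofReal_normSq_eq_dotProduct, hψ]; push_cast; ring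
  rw [heq]
  have := norm_sub_norm_le (1 : ℂ) (star ψ ⬝ᵥ (ψ - φ))
  rw [norm_one] at this
  linarith

/-- `‖ψ - φ‖² = ‖ψ‖² + ‖φ‖² - 2 Re⟨ψ|φ⟩`. [folklore] -/
private theorem normSq_sub_eq (ψ φ : QReg n → ℂ) :
    normSq (ψ - φ) = normSq ψ + normSq φ - 2 * (star ψ ⬝ᵥ φ).re := by
  have h : (normSq (ψ - φ) : ℂ) = normSq ψ + normSq φ - (star ψ ⬝ᵥ φ) - star (star ψ ⬝ᵥ φ) := by
    rw [ofReal_normSq_eq_dotProduct, ofReal_normSq_eq_dotProduct, ofReal_normSq_eq_dotProduct,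
      ← Matrix.star_dotProduct, star_sub, sub_dotProduct, dotProduct_sub, dotProduct_sub]
    ring
  have h2 := congrArg Complex.re h
  rw [Complex.ofReal_re] at h2
  rw [h2]
  simp only [Complex.sub_re, Complex.add_re, Complex.ofReal_re, Complex.star_def, Complex.conj_re]
  ring

/-- **Fidelity from distance, unit vectors**: if `‖ψ‖ = ‖φ‖ = 1` and `‖ψ - φ‖ ≤ δ` then
`|⟨ψ|φ⟩| ≥ Re⟨ψ|φ⟩ = 1 - ‖ψ-φ‖²/2 ≥ 1 - δ²/2`. [cite: BravyiEtAl2019, §5.4 Thm. 3 (hypothesis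
`‖φ‖ = 1`; the approximate reading via `|⟨H^{⊗n}|φ⟩|`)] -/
theorem one_sub_half_sq_le_norm_dotProduct {ψ φ : QReg n → ℂ} (hψ : normSq ψ = 1) (hφ : normSq φ = 1)
    {δ : ℝ} (happ : normSq (ψ - φ) ≤ δ ^ 2) : 1 - δ ^ 2 / 2 ≤ ‖star ψ ⬝ᵥ φ‖ := by
  have h := normSq_sub_eq ψ φ
  rw [hψ, hφ] at h
  have hre : (star ψ ⬝ᵥ φ).re ≤ ‖star ψ ⬝ᵥ φ‖ := Complex.re_le_norm _
  linarith

/-- **δ-robust Theorem 3 (approximate stabilizer rank over the product dictionary).** If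
`φ = Σ_{x∈S} a_x|x̂⟩` satisfies `‖T^{⊗n} - φ‖ ≤ δ ≤ 1` (the tree's `approxStabilizerRank`
convention `normSq (ψ - φ) ≤ δ²`, `φ` not necessarily normalised) then
`(1-δ)² cos(π/8)^{-2n} ≤ |S| · ‖φ‖²`; with `‖φ‖ ≤ 1 + δ` this is
`|S| ≥ ((1-δ)/(1+δ))² cos(π/8)^{-2n} ≥ ((1-δ)/(1+δ))² 2^{0.2284 n}` (`(1-δ)²` enters through
`|⟨T^{⊗n}|φ⟩| ≥ 1 - δ`, Cauchy–Schwarz). It matches, up to the `δ`-factors, Bravyi–Gosset's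
`O(δ⁻² cos(π/8)^{-2n})` construction in the same family (Bravyi et al. §2 eq. (11); the tree's
`BravyiEtAl2019_approxStabilizerRank_magicT_pow_holds`). Scope (F-a): RESTRICTED dictionary only — the
UNRESTRICTED δ-approximate rank of T^{⊗n} stays Ω̃(n²) (L-04) and the BG16 Ω(cos^{−2n}) conjecture
stays OPEN. [cite: BravyiEtAl2019, §2 Prop. 3 and §5.4 Thm. 3 (the "tight lower bound on the
approximate stabilizer rank of `T^{⊗m}`" restricted to the product states `|x̃⟩`), §2 eq. (11)] -/
theorem card_mul_normSq_ge_of_approx (S : Finset (BVec n)) (a : BVec n → ℂ) (ha : ∀ x, x ∉ S → a x = 0)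
    {δ : ℝ} (hδ0 : 0 ≤ δ) (hδ1 : δ ≤ 1)
    (happ : normSq (tensorPow magicT n - ∑ x, a x • hatState n x) ≤ δ ^ 2) :
    (1 - δ) ^ 2 * ((Real.cos (Real.pi / 8) ^ 2) ^ n)⁻¹ ≤ S.card * normSq (∑ x, a x • hatState n x) := by
  have hc : 0 < (Real.cos (Real.pi / 8) ^ 2) ^ n := pow_pos (by
    have := cos_sq_pi_div_eight_bounds.1; linarith) n
  have hT : normSq (tensorPow magicT n) = 1 := by rw [normSq_tensorPow, normSq_magicT, one_pow]
  have hov := one_sub_le_norm_dotProduct hT hδ0 happ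
  have h3 := norm_sq_overlap_le_card_mul S a ha
  have hsq : (1 - δ) ^ 2 ≤ ‖star (tensorPow magicT n) ⬝ᵥ ∑ x, a x • hatState n x‖ ^ 2 :=
    pow_le_pow_left₀ (sub_nonneg.2 hδ1) hov 2
  rw [← div_eq_mul_inv, div_le_iff₀ hc]
  calc (1 - δ) ^ 2 ≤ _ := hsq
    _ ≤ _ := h3
    _ = S.card * normSq (∑ x, a x • hatState n x) * (Real.cos (Real.pi / 8) ^ 2) ^ n := by ring

/-- **δ-robust Theorem 3, unit approximants** (Bravyi et al.'s normalisation `‖φ‖ = 1`): if moreover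
`‖φ‖ = 1` then `|⟨T^{⊗n}|φ⟩| ≥ 1 - δ²/2`, so `(1 - δ²/2)² cos(π/8)^{-2n} ≤ |S|` (`δ² ≤ 2`).
[cite: BravyiEtAl2019, §5.4 Thm. 3 with `|⟨H^{⊗n}|φ⟩|² ≥ (1-δ²/2)²`] -/
theorem card_ge_of_approx_unit (S : Finset (BVec n)) (a : BVec n → ℂ) (ha : ∀ x, x ∉ S → a x = 0)
    {δ : ℝ} (hδ : δ ^ 2 ≤ 2) (hunit : normSq (∑ x, a x • hatState n x) = 1)
    (happ : normSq (tensorPow magicT n - ∑ x, a x • hatState n x) ≤ δ ^ 2) :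
    (1 - δ ^ 2 / 2) ^ 2 * ((Real.cos (Real.pi / 8) ^ 2) ^ n)⁻¹ ≤ S.card := by
  have hT : normSq (tensorPow magicT n) = 1 := by rw [normSq_tensorPow, normSq_magicT, one_pow]
  have hov := one_sub_half_sq_le_norm_dotProduct hT hunit happ
  have hsq : (1 - δ ^ 2 / 2) ^ 2 ≤ ‖star (tensorPow magicT n) ⬝ᵥ ∑ x, a x • hatState n x‖ ^ 2 :=
    pow_le_pow_left₀ (by linarith) hov 2
  have h := card_ge_overlap_sq_mul S a ha hunit
  have hc : 0 ≤ ((Real.cos (Real.pi / 8) ^ 2) ^ n)⁻¹ := by positivity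
  exact (mul_le_mul_of_nonneg_right hsq hc).trans h

/-! ### §6 Bravyi–Gosset's Lemma 2 with the fidelity factor, and δ-robust extent floors -/

/-- `0 ≤ C`. [folklore] -/
private theorem cosT_nonneg' : 0 ≤ cosT := norm_nonneg _

/-- **Weak duality with the optimal dual witness `T^{⊗n}`** (Bravyi–Gosset Lemma 2, `ℓ¹` form, any
fidelity): for EVERY `ψ = Σ_{i∈s} cᵢ φᵢ` with stabilizer `φᵢ`,
`|⟨T^{⊗n}|ψ⟩|² ≤ cos(π/8)^{2n} · (Σᵢ |cᵢ|)²`. (`ψ = T^{⊗n}` is the tree's `extent_floor`.)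
[cite: BravyiGosset2016, Suppl. §5 Lemma 2 (proof: `f ≤ Σ_a |z_a|·|⟨φ_a|H^{⊗t}⟩| ≤ ν^t ‖z‖₁`)] -/
theorem norm_sq_overlap_le_l1_sq {ι : Type*} (s : Finset ι) (c : ι → ℂ) (φ : ι → QReg n → ℂ)
    (hφ : ∀ i ∈ s, φ i ∈ stabilizerStates n) (ψ : QReg n → ℂ) (hψ : ψ = ∑ i ∈ s, c i • φ i) :
    ‖star (tensorPow magicT n) ⬝ᵥ ψ‖ ^ 2 ≤ (Real.cos (Real.pi / 8) ^ 2) ^ n * (∑ i ∈ s, ‖c i‖) ^ 2 := by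
  have hf : ∀ i ∈ s, ‖star (φ i) ⬝ᵥ tensorPow magicT n‖ ≤ cosT ^ n := fun i hi => by
    have h := stabilizer_overlap_sq_le_cos (hφ i hi)
    rw [← cosT_sq_eq_cos_sq, ← pow_mul, mul_comm, pow_mul] at h
    exact (pow_le_pow_iff_left₀ (norm_nonneg _) (pow_nonneg cosT_nonneg' n) two_ne_zero).1 h
  have hw := weak_duality s c φ (tensorPow magicT n) ψ (cosT ^ n) hf hψ
  calc ‖star (tensorPow magicT n) ⬝ᵥ ψ‖ ^ 2 ≤ (cosT ^ n * ∑ i ∈ s, ‖c i‖) ^ 2 :=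
        pow_le_pow_left₀ (norm_nonneg _) hw 2
    _ = (cosT ^ 2) ^ n * (∑ i ∈ s, ‖c i‖) ^ 2 := by ring
    _ = _ := by rw [cosT_sq_eq_cos_sq]

/-- **Bravyi–Gosset's Lemma 2, verbatim with the fidelity factor** (`ℓ²`/rank form): for
`ψ = Σ_{i<k} cᵢ φᵢ` with stabilizer `φᵢ`, `|⟨T^{⊗n}|ψ⟩|² · cos(π/8)^{-2n} ≤ k · Σᵢ |cᵢ|²`, i.e.
`χ ≥ ν^{-2t} f² ‖z‖^{-2}` with `f = |⟨ψ|H^{⊗t}⟩|`, `ν = cos(π/8)`. (The tree's `card_mul_l2_ge` is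
the case `ψ = T^{⊗n}`, `f = 1`.) [cite: BravyiGosset2016, Suppl. §5 Lemma 2 (`χ ≥ ν^{-2t} f² ‖z‖^{-2}`)] -/
theorem norm_sq_overlap_le_card_mul_l2 {k : ℕ} (c : Fin k → ℂ) (φ : Fin k → QReg n → ℂ)
    (hφ : ∀ i, φ i ∈ stabilizerStates n) (ψ : QReg n → ℂ) (hψ : ψ = ∑ i, c i • φ i) :
    ‖star (tensorPow magicT n) ⬝ᵥ ψ‖ ^ 2 * ((Real.cos (Real.pi / 8) ^ 2) ^ n)⁻¹ ≤ k * ∑ i, ‖c i‖ ^ 2 := by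
  have hc : 0 < (Real.cos (Real.pi / 8) ^ 2) ^ n := pow_pos (by
    have := cos_sq_pi_div_eight_bounds.1; linarith) n
  have h1 := norm_sq_overlap_le_l1_sq Finset.univ c φ (fun i _ => hφ i) ψ hψ
  have h2 : (∑ i, ‖c i‖) ^ 2 ≤ k * ∑ i, ‖c i‖ ^ 2 := by
    have := Finset.sum_mul_sq_le_sq_mul_sq Finset.univ (fun i => ‖c i‖) (fun _ => (1 : ℝ))
    simp only [mul_one, one_pow, Finset.sum_const, Finset.card_univ, Fintype.card_fin, nsmul_eq_mul,
      mul_one] at this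
    linarith
  rw [← div_eq_mul_inv, div_le_iff₀ hc]
  calc ‖star (tensorPow magicT n) ⬝ᵥ ψ‖ ^ 2 ≤ _ := h1
    _ ≤ (Real.cos (Real.pi / 8) ^ 2) ^ n * (k * ∑ i, ‖c i‖ ^ 2) :=
        mul_le_mul_of_nonneg_left h2 hc.le
    _ = _ := by ring

/-- **δ-robust extent floor** (`ℓ¹`): if `ψ = Σ_{i∈s} cᵢφᵢ` (stabilizer `φᵢ`) is a `δ`-approximation of
`T^{⊗n}`, `‖T^{⊗n} - ψ‖ ≤ δ ≤ 1`, then `(1-δ)² cos(π/8)^{-2n} ≤ (Σ|cᵢ|)²` — hence the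
`δ`-approximate stabilizer extent of `T^{⊗n}` is at least `(1-δ)² (4 - 2√2)^n ≥ (1-δ)² 2^{0.2284 n}`.
[cite: BravyiGosset2016, Suppl. §5 Lemma 2 with `f ≥ 1 - δ`; BravyiEtAl2019, Def. 3 (`ξ`)] -/
theorem l1_sq_ge_of_approx {ι : Type*} (s : Finset ι) (c : ι → ℂ) (φ : ι → QReg n → ℂ)
    (hφ : ∀ i ∈ s, φ i ∈ stabilizerStates n) (ψ : QReg n → ℂ) (hψ : ψ = ∑ i ∈ s, c i • φ i)
    {δ : ℝ} (hδ0 : 0 ≤ δ) (hδ1 : δ ≤ 1) (happ : normSq (tensorPow magicT n - ψ) ≤ δ ^ 2) :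
    (1 - δ) ^ 2 * ((Real.cos (Real.pi / 8) ^ 2) ^ n)⁻¹ ≤ (∑ i ∈ s, ‖c i‖) ^ 2 := by
  have hc : 0 < (Real.cos (Real.pi / 8) ^ 2) ^ n := pow_pos (by
    have := cos_sq_pi_div_eight_bounds.1; linarith) n
  have hT : normSq (tensorPow magicT n) = 1 := by rw [normSq_tensorPow, normSq_magicT, one_pow]
  have hov := one_sub_le_norm_dotProduct hT hδ0 happ
  have hsq : (1 - δ) ^ 2 ≤ ‖star (tensorPow magicT n) ⬝ᵥ ψ‖ ^ 2 := pow_le_pow_left₀ (sub_nonneg.2 hδ1) hov 2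
  have h1 := norm_sq_overlap_le_l1_sq s c φ hφ ψ hψ
  rw [← div_eq_mul_inv, div_le_iff₀ hc]
  calc (1 - δ) ^ 2 ≤ _ := hsq
    _ ≤ _ := h1
    _ = _ := by ring

/-- **δ-robust rank·`ℓ²` floor** (Bravyi–Gosset Lemma 2 at `f ≥ 1 - δ`): a `δ`-approximation
`ψ = Σ_{i<k} cᵢφᵢ` of `T^{⊗n}` with `δ ≤ 1` has `k · Σ|cᵢ|² ≥ (1-δ)² cos(π/8)^{-2n}`; in particular an
approximate decomposition into `k` stabilizer states with `Σ|cᵢ|² ≤ B` needs `k ≥ (1-δ)² cos(π/8)^{-2n}/B`.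
[cite: BravyiGosset2016, Suppl. §5 Lemma 2 (`χ ≥ ν^{-2t} f² ‖z‖^{-2}`), with `f ≥ 1-δ`] -/
theorem card_mul_l2_ge_of_approx {k : ℕ} (c : Fin k → ℂ) (φ : Fin k → QReg n → ℂ)
    (hφ : ∀ i, φ i ∈ stabilizerStates n) (ψ : QReg n → ℂ) (hψ : ψ = ∑ i, c i • φ i)
    {δ : ℝ} (hδ0 : 0 ≤ δ) (hδ1 : δ ≤ 1) (happ : normSq (tensorPow magicT n - ψ) ≤ δ ^ 2) :
    (1 - δ) ^ 2 * ((Real.cos (Real.pi / 8) ^ 2) ^ n)⁻¹ ≤ k * ∑ i, ‖c i‖ ^ 2 := by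
  have hT : normSq (tensorPow magicT n) = 1 := by rw [normSq_tensorPow, normSq_magicT, one_pow]
  have hov := one_sub_le_norm_dotProduct hT hδ0 happ
  have hsq : (1 - δ) ^ 2 ≤ ‖star (tensorPow magicT n) ⬝ᵥ ψ‖ ^ 2 := pow_le_pow_left₀ (sub_nonneg.2 hδ1) hov 2
  have hc : 0 ≤ ((Real.cos (Real.pi / 8) ^ 2) ^ n)⁻¹ := by positivity
  exact (mul_le_mul_of_nonneg_right hsq hc).trans (norm_sq_overlap_le_card_mul_l2 c φ hφ ψ hψ)

/-- Numerical reading of the `δ`-robust floors: `(1-δ)² 2^{0.2284 n} ≤ (1-δ)² cos(π/8)^{-2n}`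
(`cos(π/8)^{-2} = 4 - 2√2 > 2^{0.2284}`, tree `xi_T_bounds`). [cite: BravyiGosset2016, p. 3
(`χ_δ ~ 2^{γt}`, `γ ≤ -2 log₂ cos(π/8) ≈ 0.228`)] -/
theorem two_rpow_mul_le_inv_cos_pow (n : ℕ) (δ : ℝ) :
    (1 - δ) ^ 2 * (2 : ℝ) ^ ((0.2284 : ℝ) * n) ≤ (1 - δ) ^ 2 * ((Real.cos (Real.pi / 8) ^ 2) ^ n)⁻¹ := by
  refine mul_le_mul_of_nonneg_left ?_ (sq_nonneg _)
  have hx : (0 : ℝ) < 4 - 2 * Real.sqrt 2 := lt_trans (by norm_num) xi_T_bounds.1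
  have h := (Real.lt_logb_iff_rpow_lt one_lt_two hx).1 gamma_bounds.1
  rw [← inv_pow, inv_cos_sq_pi_div_eight, Real.rpow_mul_natCast (by norm_num)]
  exact pow_le_pow_left₀ (Real.rpow_nonneg (by norm_num) _) h.le n

end Literature.Computability.QuantumComplexity.StabilizerFidelity.ProductFamily
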